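import Literature.Analysis.FluidPDE.SelfSimilar
import Literature.Analysis.FunctionSpaces.WeakLp
import Mathlib.Algebra.Order.Archimedean.Basic
import Mathlib.MeasureTheory.Measure.Lebesgue.EqHaar
import HarnessLib

/-!
# Discretely self-similar fields bounded on an annulus are weak-`L^d`

Analysis/FluidPDE tool file (trunk FluidKinetic), serving the tree's proof of Bradshaw–Tsai 2019,
Lemma 4.1 (`bradshawTsai2019_lemma_4_1`, `ForwardDSSApproximation.lean`). All proved.

* `nsRescaleData_inv_eq`, `nsRescaleData_zpow_eq`: the exact identity `c f(c x) = f(x)`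
  (`nsRescaleData c f = f`, `c ≠ 0`) passes to `c⁻¹` and to all integer powers of `c`.
* `norm_le_div_norm_of_nsRescaleData_eq`: if moreover `c > 1` and `‖f‖ ≤ M` on the fundamental
  annulus `{1 ≤ ‖x‖ ≤ c}`, then `‖f(x)‖ ≤ c M / ‖x‖` for all `x ≠ 0` (move `x` into the annulus
  by a power of `c`, Mathlib's `exists_mem_Ico_zpow`).
* `memWeakLp_of_norm_le_div_norm`: a field which is `O(|x|⁻¹)` lies in `L^{d,∞}` (`d = dim E`,
  additive Haar measure; Grafakos, Example 1.1.7 for the model `|x|⁻¹`), hence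
  `memWeakLp_of_nsRescaleData_eq`: **DSS fields bounded on the fundamental annulus are
  weak-`L^d`** (Bradshaw–Tsai 2019, proof of Lemma 4.1: "`|φ⁽ᵏ⁾(x)| ≤ c_k|x|⁻¹`, which implies
  `φ⁽ᵏ⁾ ∈ L³_w`").

## References

* Z. Bradshaw, T.-P. Tsai, Analysis & PDE 12 (2019), proof of Lemma 4.1 [BradshawTsai2019].
* L. Grafakos, *Classical Fourier Analysis*, 3rd ed., Example 1.1.7.
-/

noncomputable section

open MeasureTheory TopologicalSpace Set Function Filter Metric Module
open scoped ENNReal NNReal Topology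

namespace Literature.Analysis.FluidPDE

/-! ## DSS fields bounded on an annulus are `O(|x|⁻¹)`, hence weak-`L^d` -/

section DSS

variable {E : Type*} [NormedAddCommGroup E] [NormedSpace ℝ E]
variable {F : Type*} [NormedAddCommGroup F] [NormedSpace ℝ F]

/-- Exact discrete self-similarity with factor `c ≠ 0` passes to `c⁻¹`. [folklore] -/
theorem nsRescaleData_inv_eq {c : ℝ} (hc : c ≠ 0) {f : E → F} (h : nsRescaleData c f = f) :
    nsRescaleData c⁻¹ f = f := by
  conv_lhs => rw [← h]
  rw [← nsRescaleData_mul, mul_inv_cancel₀ hc, nsRescaleData_one]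

/-- Exact discrete self-similarity with factor `c ≠ 0` passes to all integer powers `c ^ n`. [folklore] -/
theorem nsRescaleData_zpow_eq {c : ℝ} (hc : c ≠ 0) {f : E → F} (h : nsRescaleData c f = f)
    (n : ℤ) : nsRescaleData (c ^ n) f = f := by
  have hnat : ∀ {a : ℝ}, nsRescaleData a f = f → ∀ m : ℕ, nsRescaleData (a ^ m) f = f := by
    intro a ha m
    induction m with
    | zero => rw [pow_zero]; exact nsRescaleData_one f
    | succ m ih => rw [pow_succ, nsRescaleData_mul, ih, ha]
  rcases Int.eq_nat_or_neg n with ⟨m, rfl | rfl⟩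
  · rw [zpow_natCast]; exact hnat h m
  · rw [zpow_neg, zpow_natCast, ← inv_pow]; exact hnat (nsRescaleData_inv_eq hc h) m

/-- **A DSS field bounded on the fundamental annulus is `O(|x|⁻¹)`**: if `c f(c x) = f(x)` for
all `x` (`c > 1`) and `‖f‖ ≤ M` on `{1 ≤ ‖x‖ ≤ c}`, then `‖f(x)‖ ≤ c M / ‖x‖` for every `x ≠ 0`
(move `x` into the annulus by an integer power of `c`). [folklore] -/
theorem norm_le_div_norm_of_nsRescaleData_eq {c : ℝ} (hc : 1 < c) {f : E → F}
    (h : nsRescaleData c f = f) {M : ℝ} (hM : ∀ x, 1 ≤ ‖x‖ → ‖x‖ ≤ c → ‖f x‖ ≤ M) {x : E}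
    (hx : x ≠ 0) : ‖f x‖ ≤ c * M / ‖x‖ := by
  have hc0 : 0 < c := zero_lt_one.trans hc
  have hxn : 0 < ‖x‖ := norm_pos_iff.2 hx
  obtain ⟨n, hn1, hn2⟩ := exists_mem_Ico_zpow hxn hc
  -- `s = c ^ (-n)` moves `x` into the annulus
  set s : ℝ := c ^ (-n) with hs
  have hs0 : 0 < s := zpow_pos hc0 _
  have hsx : s * ‖x‖ < c := by
    rw [hs, zpow_neg, inv_mul_lt_iff₀ (zpow_pos hc0 n), ← zpow_add_one₀ hc0.ne']
    exact hn2
  have hsx1 : 1 ≤ s * ‖x‖ := by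
    rw [hs, zpow_neg, le_inv_mul_iff₀ (zpow_pos hc0 n), mul_one]
    exact hn1
  have hfs : f x = s • f (s • x) := by
    have := congrFun (nsRescaleData_zpow_eq hc0.ne' h (-n)) x
    rw [nsRescaleData_apply] at this
    exact this.symm
  have hnorm : ‖s • x‖ = s * ‖x‖ := by rw [norm_smul, Real.norm_of_nonneg hs0.le]
  have hb := hM (s • x) (hnorm ▸ hsx1) (hnorm ▸ hsx.le)
  have hM0 : 0 ≤ M := (norm_nonneg _).trans hb
  rw [hfs, norm_smul, Real.norm_of_nonneg hs0.le, le_div_iff₀ hxn]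
  calc s * ‖f (s • x)‖ * ‖x‖ = (s * ‖x‖) * ‖f (s • x)‖ := by ring
    _ ≤ c * M := mul_le_mul hsx.le hb (norm_nonneg _) hc0.le

variable [MeasurableSpace E] [BorelSpace E] [FiniteDimensional ℝ E]

omit [NormedSpace ℝ F] in
/-- **A field which is `O(|x|⁻¹)` lies in weak `L^d`** (`d = dim E ≥ 1`, additive Haar
measure): `t^d μ{‖f‖ > t} ≤ t^d μ(B(0, C/t)) = C^d μ(B₁)` (Grafakos, Example 1.1.7). [folklore] -/
theorem memWeakLp_of_norm_le_div_norm [Nontrivial E] (μ : Measure E) [μ.IsAddHaarMeasure]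
    {f : E → F} (hf : AEStronglyMeasurable f μ) {C : ℝ} (hC : ∀ x, x ≠ 0 → ‖f x‖ ≤ C / ‖x‖) :
    FunctionSpaces.MemWeakLp f (finrank ℝ E : ℝ≥0∞) μ := by
  refine ⟨hf, ?_⟩
  have hd : 0 < finrank ℝ E := Module.finrank_pos
  set C' : ℝ := max C 1 with hC'
  have hC'0 : 0 < C' := lt_max_of_lt_right zero_lt_one
  have hC'le : ∀ x, x ≠ 0 → ‖f x‖ ≤ C' / ‖x‖ := fun x hx =>
    (hC x hx).trans (div_le_div_of_nonneg_right (le_max_left _ _) (norm_nonneg _))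
  refine lt_of_le_of_lt (FunctionSpaces.eWeakLpPow_le_iff.2 fun t => ?_)
    (ENNReal.mul_lt_top ENNReal.ofReal_lt_top (measure_ball_lt_top (μ := μ) (x := (0 : E))
      (r := 1)) : ENNReal.ofReal (C' ^ finrank ℝ E) * μ (ball 0 1) < ⊤)
  have hdR : ((finrank ℝ E : ℝ≥0∞)).toReal = (finrank ℝ E : ℝ) := ENNReal.toReal_natCast _
  rw [hdR, ENNReal.rpow_natCast]
  rcases eq_or_ne t 0 with rfl | ht0
  · rw [ENNReal.coe_zero, zero_pow hd.ne', zero_mul]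
    exact bot_le
  have ht : 0 < (t : ℝ) := NNReal.coe_pos.2 (pos_iff_ne_zero.2 ht0)
  -- the superlevel set sits in `{0} ∪ B(0, C'/t)`
  have hsub : {x : E | (t : ℝ≥0∞) < ‖f x‖ₑ} ⊆ {0} ∪ ball (0 : E) (C' / t) := by
    intro x hx
    rcases eq_or_ne x 0 with rfl | hx0
    · exact Or.inl rfl
    refine Or.inr (mem_ball_zero_iff.2 ?_)
    rw [mem_setOf_eq, ← ofReal_norm, ← ENNReal.ofReal_coe_nnreal,
      ENNReal.ofReal_lt_ofReal_iff_of_nonneg (NNReal.coe_nonneg t)] at hx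
    have h1 : (t : ℝ) < C' / ‖x‖ := hx.trans_le (hC'le x hx0)
    rw [lt_div_iff₀ (norm_pos_iff.2 hx0)] at h1
    rw [lt_div_iff₀ ht]
    linarith [mul_comm (t : ℝ) ‖x‖]
  calc (t : ℝ≥0∞) ^ finrank ℝ E * μ {x : E | (t : ℝ≥0∞) < ‖f x‖ₑ}
      ≤ (t : ℝ≥0∞) ^ finrank ℝ E * μ (ball (0 : E) (C' / t)) := by
        refine mul_le_mul' le_rfl ((measure_mono hsub).trans ((measure_union_le _ _).trans ?_))
        rw [measure_singleton, zero_add]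
    _ = ENNReal.ofReal (C' ^ finrank ℝ E) * μ (ball 0 1) := by
        rw [Measure.addHaar_ball_of_pos μ (0 : E) (div_pos hC'0 ht), ← mul_assoc,
          ← ENNReal.ofReal_coe_nnreal, ← ENNReal.ofReal_pow (NNReal.coe_nonneg t),
          ← ENNReal.ofReal_mul (pow_nonneg (NNReal.coe_nonneg t) _), ← mul_pow,
          mul_div_cancel₀ _ ht.ne']

/-- **DSS fields bounded on the fundamental annulus are weak-`L^d`** (`d = dim E ≥ 1`): if
`c f(c x) = f(x)` for all `x` (`c > 1`), `f` is a.e.-strongly measurable and `‖f‖ ≤ M` on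
`{1 ≤ ‖x‖ ≤ c}`, then `f ∈ L^{d,∞}` (Bradshaw–Tsai 2019, proof of Lemma 4.1: "`|φ⁽ᵏ⁾(x)| ≤
c_k|x|⁻¹`, which implies `φ⁽ᵏ⁾ ∈ L³_w`"). [cite: BradshawTsai2019, Lemma 4.1 (proof)] -/
theorem memWeakLp_of_nsRescaleData_eq [Nontrivial E] (μ : Measure E) [μ.IsAddHaarMeasure]
    {c : ℝ} (hc : 1 < c) {f : E → F} (hf : AEStronglyMeasurable f μ)
    (h : nsRescaleData c f = f) {M : ℝ} (hM : ∀ x, 1 ≤ ‖x‖ → ‖x‖ ≤ c → ‖f x‖ ≤ M) :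
    FunctionSpaces.MemWeakLp f (finrank ℝ E : ℝ≥0∞) μ :=
  memWeakLp_of_norm_le_div_norm μ hf fun _ hx => norm_le_div_norm_of_nsRescaleData_eq hc h hM hx

end DSS

end Literature.Analysis.FluidPDE

end
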